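import Literature.Computability.Cryptography.OracleKickback
import HarnessLib

/-!
# Blocks of oracle gates writing a classical function into a register

Topic `Literature/Computability/QuantumComplexity`. In an algorithm with a subroutine for a language
`A` (an oracle gate `|q, b⟩ ↦ |q, b ⊕ [q ∈ A]⟩`, Nielsen–Chuang 2010, §6.1.1 eq. (6.2);
Bennett–Bernstein–Brassard–Vazirani 1997, Cor. 4.15 for `A ∈ BQP`), a many-bit CLASSICAL value
`f(r)` of the content `r` of some registers is obtained by asking, bit by bit, the language
"bit `i` of `f(r)`" into the wires of a clean register, and is ERASED later by asking again
(Bennett 1973, compute–use–uncompute; van Dam–Seroussi 2002, §3 Lemma 1: "|χ⟩ can be prepared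
using Shor's discrete logarithm algorithm" — the discrete logarithms are fetched, used for a phase,
and unfetched). This file proves the basis-state semantics of such blocks in the tree's model:

* `OracleXor.run A gs x` — the label reached from `x` by a list of placed oracle gates
  (`oracleTarget` folded), and **`toMatrix_oracles_mulVec_basisState`**: the circuit of the gates maps
  `|x⟩` to `|run A gs x⟩` (no hypothesis: oracle gates permute basis states);
* under DISJOINTNESS (targets pairwise distinct, no target is a query wire of any gate of the block):
  `run_apply_of_notTarget` (untargeted wires are unchanged) and **`run_apply_target`** (the target of
  gate `g` ends as `x(t) ⊕ [queryOf g x ∈ A]`, the query being read on the ORIGINAL label);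
* `OracleXor.xorEmb hdr src t` — the placement "header wires, source wires, target" of one gate
  (`queryOf_xorEmb`: its query string is `hdr-bits ++ src-bits`), for the blocks of the van
  Dam–Seroussi circuit whose queries are a constant header spelled on constant wires followed by
  quantum registers.

Everything is proved; the definitions have bodies; no named fact.

## References

* M. A. Nielsen, I. L. Chuang, *Quantum Computation and Quantum Information*, CUP 2010, §6.1.1
  eq. (6.2), §3.2.5 (uncomputation) [NielsenChuang2010].
* C. H. Bennett, *Logical reversibility of computation*, IBM J. Res. Develop. 17 (1973), §2 [Bennett1973].
* C. H. Bennett, E. Bernstein, G. Brassard, U. Vazirani, SIAM J. Comput. 26 (1997), Cor. 4.15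
  [BennettBernsteinBrassardVazirani1997].
* W. van Dam, G. Seroussi, arXiv:quant-ph/0207131 (2002), §3 Lemma 1 [VanDamSeroussi2002].
-/

noncomputable section

namespace Literature.Computability.QuantumComplexity

open Cryptography Matrix

namespace OracleXor

variable {G : QGateSet} {N : ℕ}

/-! ### A list of oracle gates on a basis state -/

/-- A placed oracle gate as data: `k` query wires and the placement of its `k + 1` wires. [folklore] -/
abbrev OGate (N : ℕ) : Type := Σ k : ℕ, Fin (k + 1) ↪ Fin N

/-- The gate of the data. [folklore] -/
def OGate.toGate (g : OGate N) : QGate G N := QGate.oracle g.1 g.2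

/-- The target (answer) wire of the gate. [folklore] -/
def OGate.target (g : OGate N) : Fin N := g.2 (Fin.last g.1)

/-- The query wires of the gate. [folklore] -/
def OGate.queries (g : OGate N) : Set (Fin N) := Set.range fun i : Fin g.1 => g.2 i.castSucc

/-- **The label reached by a list of oracle gates** (head first): the XOR maps folded.
[cite: NielsenChuang2010, §6.1.1 eq. (6.2)] -/
def run (A : Language Bool) : List (OGate N) → QReg N → QReg N
  | [], x => x
  | g :: gs, x => run A gs (oracleTarget A g.2 x)

/-- The circuit of a list of oracle gates. [folklore] -/
def circuit (gs : List (OGate N)) : QCircuit G N := ⟨gs.map OGate.toGate⟩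

/-- **A list of oracle gates permutes basis states**: `U |x⟩ = |run x⟩`. [cite: NielsenChuang2010, §6.1.1 eq. (6.2)] -/
theorem toMatrix_oracles_mulVec_basisState (A : Language Bool) :
    ∀ (gs : List (OGate N)) (x : QReg N), (circuit gs : QCircuit G N).toMatrix A *ᵥ basisState x = basisState (run A gs x)
  | [], x => by simp [circuit, run]
  | g :: gs, x => by
    rw [circuit, List.map_cons, QCircuit.toMatrix_cons, ← Matrix.mulVec_mulVec, OGate.toGate, QGate.toMatrix_oracle,
      placeGate_oracleGate_mulVec_basisState]
    exact toMatrix_oracles_mulVec_basisState A gs _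

/-- The circuit of oracle gates has no gate symbols to be oracle-free about: it is a list of oracle
gates (recorded for the substitution count). [folklore] -/
theorem length_circuit_gates (gs : List (OGate N)) : (circuit gs : QCircuit G N).gates.length = gs.length := by
  simp [circuit]

/-! ### Disjoint blocks -/

/-- **A disjoint block**: the targets are pairwise distinct and no target is a query wire of any gate
of the block. [folklore] -/
def Disjoint (gs : List (OGate N)) : Prop :=
  (gs.map OGate.target).Nodup ∧ ∀ g ∈ gs, ∀ g' ∈ gs, g.target ∉ g'.queries

/-- The tail of a disjoint block is disjoint. [folklore] -/
theorem Disjoint.tail {g : OGate N} {gs : List (OGate N)} (h : Disjoint (g :: gs)) : Disjoint gs :=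
  ⟨(List.nodup_cons.1 h.1).2, fun a ha b hb => h.2 a (List.mem_cons_of_mem _ ha) b (List.mem_cons_of_mem _ hb)⟩

/-- `oracleTarget` changes only the target wire. [folklore] -/
theorem oracleTarget_apply_of_ne (A : Language Bool) (g : OGate N) (x : QReg N) {w : Fin N} (hw : w ≠ g.target) :
    oracleTarget A g.2 x w = x w := by
  unfold oracleTarget OGate.target at *
  rw [Function.update_of_ne hw]

/-- The query of a gate does not see a change off its query wires. [folklore] -/
theorem queryOf_eq_of_agree (g : OGate N) {x y : QReg N} (h : ∀ w ∈ g.queries, x w = y w) : queryOf g.2 x = queryOf g.2 y := by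
  unfold queryOf
  exact List.ofFn_inj.2 (funext fun i => h _ ⟨i, rfl⟩)

/-- **Untargeted wires are unchanged by the block.** [folklore] -/
theorem run_apply_of_notTarget (A : Language Bool) :
    ∀ (gs : List (OGate N)) (x : QReg N) {w : Fin N}, (∀ g ∈ gs, w ≠ g.target) → run A gs x w = x w
  | [], x, w, _ => rfl
  | g :: gs, x, w, hw => by
    rw [run, run_apply_of_notTarget A gs _ (fun g' hg' => hw g' (List.mem_cons_of_mem _ hg')),
      oracleTarget_apply_of_ne A g x (hw g (List.mem_cons_self ..))]

/-- **The target of a gate of a disjoint block** ends as `x(t) ⊕ [queryOf g x ∈ A]`, the query read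
on the original label. [cite: NielsenChuang2010, §6.1.1 eq. (6.2)] [cite: Bennett1973, §2] -/
theorem run_apply_target (A : Language Bool) :
    ∀ (gs : List (OGate N)), Disjoint gs → ∀ (x : QReg N), ∀ g ∈ gs,
      run A gs x g.target = (x g.target ^^ A.boolIndicator (queryOf g.2 x))
  | [], _, x, g, hg => absurd hg List.not_mem_nil
  | g₀ :: gs, hd, x, g, hg => by
    rw [run]
    rcases List.mem_cons.1 hg with rfl | hg'
    · -- the head gate: its target is untouched afterwards
      have hne : ∀ g' ∈ gs, g.target ≠ g'.target := by
        intro g' hg' he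
        have hnd := hd.1
        rw [List.map_cons, List.nodup_cons] at hnd
        exact hnd.1 (by rw [he]; exact List.mem_map.2 ⟨g', hg', rfl⟩)
      rw [run_apply_of_notTarget A gs _ hne]
      unfold oracleTarget OGate.target
      rw [Function.update_self]
    · -- a later gate: the head gate changed neither its target nor its query wires
      rw [run_apply_target A gs hd.tail _ g hg']
      have h1 : oracleTarget A g₀.2 x g.target = x g.target := by
        refine oracleTarget_apply_of_ne A g₀ x fun he => ?_
        have hnd := hd.1
        rw [List.map_cons, List.nodup_cons] at hnd
        exact hnd.1 (by rw [← he]; exact List.mem_map.2 ⟨g, hg', rfl⟩)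
      have h2 : queryOf g.2 (oracleTarget A g₀.2 x) = queryOf g.2 x :=
        queryOf_eq_of_agree g fun w hw => oracleTarget_apply_of_ne A g₀ x fun he =>
          hd.2 g₀ (List.mem_cons_self ..) g hg (he ▸ hw)
      rw [h1, h2]

/-- **The block on a label whose targets are clean** writes the answer bits: the target of `g` ends as
`[queryOf g x ∈ A]`. [cite: NielsenChuang2010, §6.1.1 eq. (6.2)] -/
theorem run_apply_target_of_clean (A : Language Bool) {gs : List (OGate N)} (hd : Disjoint gs) (x : QReg N)
    (hclean : ∀ g ∈ gs, x g.target = false) {g : OGate N} (hg : g ∈ gs) :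
    run A gs x g.target = A.boolIndicator (queryOf g.2 x) := by
  rw [run_apply_target A gs hd x g hg, hclean g hg, Bool.false_xor]

/-- **Asking twice erases**: on a label whose targets hold exactly the answer bits, the block clears
them. [cite: Bennett1973, §2 (uncompute by recomputing)] -/
theorem run_apply_target_of_written (A : Language Bool) {gs : List (OGate N)} (hd : Disjoint gs) (x : QReg N)
    (hw : ∀ g ∈ gs, x g.target = A.boolIndicator (queryOf g.2 x)) {g : OGate N} (hg : g ∈ gs) :
    run A gs x g.target = false := by
  rw [run_apply_target A gs hd x g hg, hw g hg, Bool.xor_self]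

/-! ### The placement "header, sources, target" -/

section Emb

variable {h s : ℕ}

/-- The wire map of a gate reading `h` header wires, then `s` source wires, then answering on `t`.
[folklore] -/
def xorMap (hdr : Fin h ↪ Fin N) (src : Fin s ↪ Fin N) (t : Fin N) (i : Fin (h + s + 1)) : Fin N :=
  Fin.lastCases t (fun j : Fin (h + s) => Fin.addCases (motive := fun _ => Fin N) (fun a => hdr a) (fun b => src b) j) i

/-- `xorMap` on the last wire is the target. [folklore] -/
@[simp] theorem xorMap_last (hdr : Fin h ↪ Fin N) (src : Fin s ↪ Fin N) (t : Fin N) :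
    xorMap hdr src t (Fin.last (h + s)) = t := by
  rw [xorMap, Fin.lastCases_last]

/-- `xorMap` on a header wire. [folklore] -/
@[simp] theorem xorMap_castSucc_castAdd (hdr : Fin h ↪ Fin N) (src : Fin s ↪ Fin N) (t : Fin N) (a : Fin h) :
    xorMap hdr src t (Fin.castSucc (Fin.castAdd s a)) = hdr a := by
  rw [xorMap, Fin.lastCases_castSucc, Fin.addCases_left]

/-- `xorMap` on a source wire. [folklore] -/
@[simp] theorem xorMap_castSucc_natAdd (hdr : Fin h ↪ Fin N) (src : Fin s ↪ Fin N) (t : Fin N) (b : Fin s) :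
    xorMap hdr src t (Fin.castSucc (Fin.natAdd h b)) = src b := by
  rw [xorMap, Fin.lastCases_castSucc, Fin.addCases_right]

/-- **The placement of a header/sources/target gate**, injective when the three parts are pairwise
disjoint. [folklore] -/
def xorEmb (hdr : Fin h ↪ Fin N) (src : Fin s ↪ Fin N) (t : Fin N)
    (hhs : ∀ a b, hdr a ≠ src b) (hht : ∀ a, hdr a ≠ t) (hst : ∀ b, src b ≠ t) : Fin (h + s + 1) ↪ Fin N :=
  ⟨xorMap hdr src t, by
    intro i i' hii'
    induction i using Fin.lastCases with
    | last =>
      induction i' using Fin.lastCases with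
      | last => rfl
      | cast j' =>
        exfalso
        rw [xorMap_last] at hii'
        induction j' using Fin.addCases with
        | left a => rw [xorMap_castSucc_castAdd] at hii'; exact hht a hii'.symm
        | right b => rw [xorMap_castSucc_natAdd] at hii'; exact hst b hii'.symm
    | cast j =>
      induction i' using Fin.lastCases with
      | last =>
        exfalso
        rw [xorMap_last] at hii'
        induction j using Fin.addCases with
        | left a => rw [xorMap_castSucc_castAdd] at hii'; exact hht a hii'
        | right b => rw [xorMap_castSucc_natAdd] at hii'; exact hst b hii'
      | cast j' =>
        rw [Fin.castSucc_inj]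
        induction j using Fin.addCases with
        | left a =>
          induction j' using Fin.addCases with
          | left a' =>
            rw [xorMap_castSucc_castAdd, xorMap_castSucc_castAdd] at hii'
            rw [hdr.injective hii']
          | right b' =>
            rw [xorMap_castSucc_castAdd, xorMap_castSucc_natAdd] at hii'
            exact absurd hii' (hhs a b')
        | right b =>
          induction j' using Fin.addCases with
          | left a' =>
            rw [xorMap_castSucc_natAdd, xorMap_castSucc_castAdd] at hii'
            exact absurd hii'.symm (hhs a' b)
          | right b' =>
            rw [xorMap_castSucc_natAdd, xorMap_castSucc_natAdd] at hii'
            rw [src.injective hii']⟩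

/-- `xorEmb` as a function is `xorMap`. [folklore] -/
@[simp] theorem xorEmb_apply (hdr : Fin h ↪ Fin N) (src : Fin s ↪ Fin N) (t : Fin N)
    (hhs : ∀ a b, hdr a ≠ src b) (hht : ∀ a, hdr a ≠ t) (hst : ∀ b, src b ≠ t) (i : Fin (h + s + 1)) :
    xorEmb hdr src t hhs hht hst i = xorMap hdr src t i := rfl

/-- **The query of a header/sources/target gate** is the header bits followed by the source bits.
[folklore] -/
theorem queryOf_xorEmb (hdr : Fin h ↪ Fin N) (src : Fin s ↪ Fin N) (t : Fin N)
    (hhs : ∀ a b, hdr a ≠ src b) (hht : ∀ a, hdr a ≠ t) (hst : ∀ b, src b ≠ t) (x : QReg N) :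
    queryOf (xorEmb hdr src t hhs hht hst) x = List.ofFn (x ∘ hdr) ++ List.ofFn (x ∘ src) := by
  unfold queryOf
  rw [← List.ofFn_fin_append]
  refine List.ofFn_inj.2 (funext fun i => ?_)
  simp only [xorEmb_apply]
  induction i using Fin.addCases with
  | left a => rw [Fin.append_left, xorMap_castSucc_castAdd]; rfl
  | right b => rw [Fin.append_right, xorMap_castSucc_natAdd]; rfl

/-- The target of a header/sources/target gate. [folklore] -/
theorem target_xorEmb (hdr : Fin h ↪ Fin N) (src : Fin s ↪ Fin N) (t : Fin N)
    (hhs : ∀ a b, hdr a ≠ src b) (hht : ∀ a, hdr a ≠ t) (hst : ∀ b, src b ≠ t) :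
    OGate.target (⟨h + s, xorEmb hdr src t hhs hht hst⟩ : OGate N) = t := by
  simp [OGate.target]

/-- The query wires of a header/sources/target gate are the header and source wires. [folklore] -/
theorem mem_queries_xorEmb_iff (hdr : Fin h ↪ Fin N) (src : Fin s ↪ Fin N) (t : Fin N)
    (hhs : ∀ a b, hdr a ≠ src b) (hht : ∀ a, hdr a ≠ t) (hst : ∀ b, src b ≠ t) (w : Fin N) :
    w ∈ OGate.queries (⟨h + s, xorEmb hdr src t hhs hht hst⟩ : OGate N) ↔ (∃ a, hdr a = w) ∨ ∃ b, src b = w := by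
  simp only [OGate.queries, Set.mem_range, xorEmb_apply]
  constructor
  · rintro ⟨i, rfl⟩
    induction i using Fin.addCases with
    | left a => exact Or.inl ⟨a, by rw [xorMap_castSucc_castAdd]⟩
    | right b => exact Or.inr ⟨b, by rw [xorMap_castSucc_natAdd]⟩
  · rintro (⟨a, rfl⟩ | ⟨b, rfl⟩)
    · exact ⟨Fin.castAdd s a, by rw [xorMap_castSucc_castAdd]⟩
    · exact ⟨Fin.natAdd h b, by rw [xorMap_castSucc_natAdd]⟩

end Emb

end OracleXor

end Literature.Computability.QuantumComplexity

end
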